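import Summits.AtomisticToContinuum.BoseEinsteinCondensation.Theses.ScaleConvexity

/-!
# Route ScaleConvexity — the dyadic coherent-fraction profile: definitions and the fraction calculus (`Φ ≤ 1`)

Part 1 of the proof of the support item `ScaleConvexity.ProfileEngine` (decomp-a2c lens-6 g7 node file, sufficiency
half). Named helpers `IsModeOn`, `modeOcc`, `mass`, `frac`, `NonSteepAt`, `PolyScaleAt` (the route items inline them
verbatim, so everything here unfolds definitionally against the route file), and the FRACTION CALCULUS:
`modeOcc ≤ mass` cube by cube (slice Cauchy–Schwarz + Tonelli), hence `Φ_j ≤ 1`, `Φ_j ≠ ⊤`; the level-0 cube contains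
the box, so its mass is `N` and `N · Φ_0 ≤ λ_max(γ_Ψ)`.  Part 2 (`ScaleConvexityProfileEngine.lean`) adds the
loss-telescoping engine, level counting and the theorem `profileEngine_holds`. [objects: LSSY2005 §1.2]
-/

noncomputable section

namespace Summit.AtomisticToContinuum.BoseEinsteinCondensation.Theorems.ScaleConvexityFractionCalculus

open scoped BigOperators Topology Classical MeasureTheory ComplexConjugate ENNReal NNReal
open Filter Set Function MeasureTheory

/-! ### Node-file helpers (NOT items; the items below inline them verbatim) -/

section Helpers
open Literature.MathematicalPhysics.QuantumManyBody.BoseGas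

/-- A normalised measurable one-body mode vanishing off a coordinate cube of side `s ≤ ℓ` (g6 frame, verbatim). -/
def IsLocalMode (ℓ : ℝ) (φ : EuclideanSpace ℝ (Fin 3) → ℂ) : Prop :=
  AEStronglyMeasurable φ volume ∧ (∫⁻ x, (‖φ x‖₊ : ENNReal) ^ 2) = 1 ∧
    ∃ (a : EuclideanSpace ℝ (Fin 3)) (s : ℝ), 0 < s ∧ s ≤ ℓ ∧
      ∀ x : EuclideanSpace ℝ (Fin 3), (∃ i : Fin 3, x i < a i ∨ a i + s ≤ x i) → φ x = 0

/-- Local condensation at scale `ℓ` with constant `c` (the parent's frame, verbatim). -/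
def LocallyCondensed (v : ℝ → ENNReal) (ρ ℓ c : ℝ) : Prop :=
  ∀ᶠ N : ℕ in Filter.atTop, ∃ δ : ENNReal, 0 < δ ∧
    ∀ Ψ : TrialState N (sideLength ρ N), energy v Ψ ≤ groundStateEnergy v N (sideLength ρ N) + δ →
      ∃ φ : EuclideanSpace ℝ (Fin 3) → ℂ, IsLocalMode ℓ φ ∧ ENNReal.ofReal (c * ρ * ℓ ^ 3) ≤ occupation N φ Ψ.ψ

/-- Scale-uniform local condensation (R2, the hypothesis of the parent's residual). -/
def ScaleUniformAt (v : ℝ → ENNReal) (ρ : ℝ) : Prop :=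
  ∃ c : ℝ, 0 < c ∧ ∀ ℓ : ℝ, 0 < ℓ → LocallyCondensed v ρ ℓ c

/-- Coherent doubling with gain (Q, g6's middle statement, verbatim). -/
def DoublingAt (v : ℝ → ENNReal) (ρ : ℝ) : Prop :=
  ∃ c₀ : ℝ, 0 < c₀ ∧ ∃ η : ℝ, 0 < η ∧ ∃ ℓ₀ : ℝ, 0 < ℓ₀ ∧
    ∀ᶠ N : ℕ in Filter.atTop, ∃ δ : ENNReal, 0 < δ ∧
      ∀ Ψ : TrialState N (sideLength ρ N), energy v Ψ ≤ groundStateEnergy v N (sideLength ρ N) + δ →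
        ∀ ℓ : ℝ, ℓ₀ ≤ ℓ → 2 * ℓ ≤ sideLength ρ N →
          ∀ φ : EuclideanSpace ℝ (Fin 3) → ℂ, IsLocalMode ℓ φ →
            ∃ φ' : EuclideanSpace ℝ (Fin 3) → ℂ, IsLocalMode (2 * ℓ) φ' ∧
              min (ENNReal.ofReal (c₀ * ρ * (2 * ℓ) ^ 3)) ((1 + ENNReal.ofReal η) * occupation N φ Ψ.ψ) ≤
                occupation N φ' Ψ.ψ

/-- THE NEW OBJECT, part 1: a normalised measurable one-body mode vanishing off the set `Q`. -/
def IsModeOn (Q : Set (EuclideanSpace ℝ (Fin 3))) (φ : EuclideanSpace ℝ (Fin 3) → ℂ) : Prop :=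
  AEStronglyMeasurable φ volume ∧ (∫⁻ x, (‖φ x‖₊ : ENNReal) ^ 2) = 1 ∧
    ∀ x : EuclideanSpace ℝ (Fin 3), x ∉ Q → φ x = 0

/-- Best coherent occupation `sup_φ ⟨φ, γ_Ψ φ⟩` over modes on `Q`. -/
def modeOcc (N : ℕ) (Q : Set (EuclideanSpace ℝ (Fin 3))) (Ψ : Config N → ℂ) : ENNReal :=
  ⨆ (φ : EuclideanSpace ℝ (Fin 3) → ℂ) (_ : IsModeOn Q φ), occupation N φ Ψ

/-- Expected particle number `∫_Q ρ_Ψ` in `Q`. -/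
def mass (N : ℕ) (Q : Set (EuclideanSpace ℝ (Fin 3))) (Ψ : Config N → ℂ) : ENNReal :=
  ∫⁻ x in Q, oneParticleDensity N Ψ x

/-- THE DYADIC COHERENT-FRACTION PROFILE `Φ_j(Ψ)`: the best, over the `8^j` grid cubes of side `L/2^j` of the
cell `[0,L)³`, of (best mode occupation in the cube) / (expected particle number in the cube). -/
def frac (N : ℕ) (L : ℝ) (j : ℕ) (Ψ : Config N → ℂ) : ENNReal :=
  ⨆ q : SubIdx (2 ^ j), modeOcc N (subCell (L / 2 ^ j) q) Ψ / mass N (subCell (L / 2 ^ j) q) Ψ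

/-- P₁ per density: NON-STEEPENING OF THE LOSS (division-free; `Φ` pinned to `frac` by the hypothesis). -/
def NonSteepAt (v : ℝ → ENNReal) (ρ : ℝ) : Prop :=
  ∃ c₀ : ℝ, 0 < c₀ ∧ ∃ s : ℝ, 0 < s ∧ ∃ ℓ₀ : ℝ, 0 < ℓ₀ ∧
    ∀ᶠ N : ℕ in Filter.atTop, ∃ δ : ENNReal, 0 < δ ∧
      ∀ Ψ : TrialState N (sideLength ρ N), energy v Ψ ≤ groundStateEnergy v N (sideLength ρ N) + δ →
        ∀ Φ : ℕ → ENNReal, (∀ j : ℕ, Φ j = frac N (sideLength ρ N) j Ψ.ψ) →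
          ∀ k k' : ℕ, 1 ≤ k' → k' < k → ℓ₀ ≤ sideLength ρ N / 2 ^ k →
            ENNReal.ofReal c₀ ≤ Φ (k' - 1) ∨
              (1 + ENNReal.ofReal s) * Φ (k - 1) * Φ k' ≤ ENNReal.ofReal s * Φ k * Φ k' + Φ (k' - 1) * Φ k

/-- P₂ per density: CONDENSATION UP TO THE POLYNOMIAL SCALE `L^θ`. -/
def PolyScaleAt (v : ℝ → ENNReal) (ρ : ℝ) : Prop :=
  ∃ θ : ℝ, 0 < θ ∧ θ < 1 ∧ ∃ c : ℝ, 0 < c ∧ ∃ ℓ₀ : ℝ, 0 < ℓ₀ ∧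
    ∀ᶠ N : ℕ in Filter.atTop, ∃ δ : ENNReal, 0 < δ ∧
      ∀ Ψ : TrialState N (sideLength ρ N), energy v Ψ ≤ groundStateEnergy v N (sideLength ρ N) + δ →
        ∀ Φ : ℕ → ENNReal, (∀ j : ℕ, Φ j = frac N (sideLength ρ N) j Ψ.ψ) →
          ∀ j : ℕ, ℓ₀ ≤ sideLength ρ N / 2 ^ j → sideLength ρ N / 2 ^ j ≤ sideLength ρ N ^ θ →
            ENNReal.ofReal c ≤ Φ j

end Helpers


/-! ### KERNEL: `Φ ≤ 1` (Cauchy–Schwarz) and the top level `Φ_0 = λ_max/N` -/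

section FractionCalculus
open Literature.MathematicalPhysics.QuantumManyBody.BoseGas

variable {n : ℕ}

/-- A Dirichlet trial state vanishes at configurations whose first particle lies outside the box. -/
theorem slice_eq_zero' {L : ℝ} (Ψ : TrialState (n + 1) L) {x : Space} (hx : x ∉ box L)
    (Y : Config n) : Ψ.ψ (Matrix.vecCons x Y) = 0 :=
  Ψ.eq_zero _ fun h => hx (by simpa using h 0)

/-- Slice Cauchy–Schwarz: for a normalised mode `φ` vanishing off `Q`,
`|∫ conj φ · Ψ(·,Y)|² ≤ ∫_Q |Ψ(x,Y)|² dx`. -/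
theorem slice_sq_le_setLIntegral {Q : Set Space} (hQ : MeasurableSet Q) {Ψ : Config (n + 1) → ℂ}
    (hΨ : Measurable Ψ) {φ : Space → ℂ} (hφ : IsModeOn Q φ) (Y : Config n) :
    (‖∫ x, conj (φ x) * Ψ (Matrix.vecCons x Y)‖₊ : ℝ≥0∞) ^ 2 ≤
      ∫⁻ x, Q.indicator (fun x => (‖Ψ (Matrix.vecCons x Y)‖₊ : ℝ≥0∞) ^ 2) x := by
  obtain ⟨hφm, hφ1, hφ0⟩ := hφ
  set g : Space → ℂ := Q.indicator fun x => Ψ (Matrix.vecCons x Y) with hg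
  have hgm : Measurable g := (measurable_comp_vecCons_left hΨ Y).indicator hQ
  have hpt : ∀ x, conj (φ x) * Ψ (Matrix.vecCons x Y) = conj (φ x) * g x := by
    intro x
    by_cases hx : x ∈ Q
    · simp [hg, Set.indicator_of_mem hx]
    · simp [hφ0 x hx]
  have hnorm : ∀ x, (‖conj (φ x) * g x‖₊ : ℝ≥0∞) = (‖φ x‖₊ : ℝ≥0∞) * (‖g x‖₊ : ℝ≥0∞) := by
    intro x; rw [nnnorm_mul, ENNReal.coe_mul]; simp
  have hf : AEMeasurable (fun x => (‖φ x‖₊ : ℝ≥0∞)) volume := hφm.aemeasurable.nnnorm.coe_nnreal_ennreal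
  have hg' : AEMeasurable (fun x => (‖g x‖₊ : ℝ≥0∞)) volume := hgm.nnnorm.coe_nnreal_ennreal.aemeasurable
  have hcs := ENNReal.lintegral_mul_le_Lp_mul_Lq volume Real.HolderConjugate.two_two hf hg'
  have hφ1' : ∫⁻ x, (‖φ x‖₊ : ℝ≥0∞) ^ (2 : ℝ) = 1 := by
    rw [← hφ1]; refine lintegral_congr fun x => ?_; rw [ENNReal.rpow_two]
  simp only [Pi.mul_apply, hφ1', ENNReal.one_rpow, one_mul] at hcs
  have hgsq : ∫⁻ x, (‖g x‖₊ : ℝ≥0∞) ^ (2 : ℝ) =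
      ∫⁻ x, Q.indicator (fun x => (‖Ψ (Matrix.vecCons x Y)‖₊ : ℝ≥0∞) ^ 2) x := by
    refine lintegral_congr fun x => ?_
    rw [ENNReal.rpow_two]
    by_cases hx : x ∈ Q
    · simp [hg, Set.indicator_of_mem hx]
    · simp [hg, Set.indicator_of_notMem hx]
  calc (‖∫ x, conj (φ x) * Ψ (Matrix.vecCons x Y)‖₊ : ℝ≥0∞) ^ 2
      = (‖∫ x, conj (φ x) * g x‖₊ : ℝ≥0∞) ^ 2 := by simp only [hpt]
    _ ≤ (∫⁻ x, (‖conj (φ x) * g x‖₊ : ℝ≥0∞)) ^ 2 := by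
        gcongr; exact enorm_integral_le_lintegral_enorm _
    _ = (∫⁻ x, (‖φ x‖₊ : ℝ≥0∞) * (‖g x‖₊ : ℝ≥0∞)) ^ 2 := by simp only [hnorm]
    _ ≤ ((∫⁻ x, (‖g x‖₊ : ℝ≥0∞) ^ (2 : ℝ)) ^ (1 / (2 : ℝ))) ^ 2 := by gcongr
    _ = ∫⁻ x, (‖g x‖₊ : ℝ≥0∞) ^ (2 : ℝ) := by
        rw [← ENNReal.rpow_two, ← ENNReal.rpow_mul]; norm_num
    _ = _ := hgsq

/-- `∫ dY ∫_Q |Ψ(x,Y)|² dx = ∫_Q sliceMass Ψ` (Tonelli). -/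
theorem lintegral_lintegral_indicator_sq {Q : Set Space} (hQ : MeasurableSet Q) {Ψ : Config (n + 1) → ℂ}
    (hΨ : Measurable Ψ) :
    ∫⁻ Y : Config n, ∫⁻ x, Q.indicator (fun x => (‖Ψ (Matrix.vecCons x Y)‖₊ : ℝ≥0∞) ^ 2) x =
      ∫⁻ x in Q, sliceMass Ψ x := by
  set G : Config (n + 1) → ℝ≥0∞ := fun X =>
    Q.indicator (fun _ => (1 : ℝ≥0∞)) (X 0) * (‖Ψ X‖₊ : ℝ≥0∞) ^ 2 with hG
  have hGm : Measurable G :=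
    ((measurable_const.indicator hQ).comp (measurable_pi_apply 0)).mul
      (hΨ.nnnorm.coe_nnreal_ennreal.pow_const 2)
  have hGcons : ∀ (x : Space) (Y : Config n), G (Matrix.vecCons x Y) =
      Q.indicator (fun x => (‖Ψ (Matrix.vecCons x Y)‖₊ : ℝ≥0∞) ^ 2) x := by
    intro x Y
    simp only [hG, Matrix.cons_val_zero]
    by_cases hx : x ∈ Q
    · simp [Set.indicator_of_mem hx]
    · simp [Set.indicator_of_notMem hx]
  have h1 : ∫⁻ Y : Config n, ∫⁻ x, Q.indicator (fun x => (‖Ψ (Matrix.vecCons x Y)‖₊ : ℝ≥0∞) ^ 2) x =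
      ∫⁻ X, G X := by
    rw [lintegral_config_succ hGm]; simp only [hGcons]
  have h2 : ∫⁻ x, ∫⁻ Y : Config n, G (Matrix.vecCons x Y) = ∫⁻ X, G X := lintegral_lintegral_vecCons hGm
  rw [h1, ← h2]
  have h3 : ∀ x, ∫⁻ Y : Config n, G (Matrix.vecCons x Y) =
      Q.indicator (fun _ => (1 : ℝ≥0∞)) x * sliceMass Ψ x := by
    intro x
    simp only [hG, Matrix.cons_val_zero, sliceMass]
    rw [lintegral_const_mul' _ _ (by by_cases hx : x ∈ Q <;> simp [hx])]
  simp only [h3]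
  rw [← lintegral_indicator hQ]
  refine lintegral_congr fun x => ?_
  by_cases hx : x ∈ Q
  · simp [Set.indicator_of_mem hx]
  · simp [Set.indicator_of_notMem hx]

/-- **`Φ ≤ 1`, cube by cube**: the occupation of a mode on `Q` is at most the expected particle number in `Q`. -/
theorem occupation_le_mass {N : ℕ} {Q : Set Space} (hQ : MeasurableSet Q) {Ψ : Config N → ℂ}
    (hΨ : Measurable Ψ) {φ : Space → ℂ} (hφ : IsModeOn Q φ) : occupation N φ Ψ ≤ mass N Q Ψ := by
  cases N with
  | zero => simp [occupation]
  | succ n =>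
    simp only [occupation, mass, oneParticleDensity]
    rw [lintegral_const_mul' _ _ (by simp : (n + 1 : ℝ≥0∞) ≠ ⊤), ← lintegral_lintegral_indicator_sq hQ hΨ]
    gcongr with Y
    exact slice_sq_le_setLIntegral hQ hΨ hφ Y

/-- `modeOcc ≤ mass` on a measurable set: the best coherent occupation on `Q` is at most `∫_Q ρ_Ψ`. -/
theorem modeOcc_le_mass {N : ℕ} {Q : Set Space} (hQ : MeasurableSet Q) {Ψ : Config N → ℂ}
    (hΨ : Measurable Ψ) : modeOcc N Q Ψ ≤ mass N Q Ψ :=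
  iSup₂_le fun _ hφ => occupation_le_mass hQ hΨ hφ

/-- A mode on `Q` is in particular a normalised mode: `modeOcc Q Ψ ≤ λ_max(γ_Ψ)`. -/
theorem modeOcc_le_maxOccupation {N : ℕ} (Q : Set Space) (Ψ : Config N → ℂ) :
    modeOcc N Q Ψ ≤ maxOccupation N Ψ :=
  iSup₂_le fun _ hφ => occupation_le_maxOccupation Ψ hφ.1 hφ.2.1

/-- **`Φ_j ≤ 1`.** -/
theorem frac_le_one {N : ℕ} (L : ℝ) (j : ℕ) {Ψ : Config N → ℂ} (hΨ : Measurable Ψ) : frac N L j Ψ ≤ 1 := by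
  refine iSup_le fun q => ENNReal.div_le_of_le_mul ?_
  rw [one_mul]
  exact modeOcc_le_mass (measurableSet_subCell _ q) hΨ

/-- `Φ_j` is finite. -/
theorem frac_ne_top {N : ℕ} (L : ℝ) (j : ℕ) {Ψ : Config N → ℂ} (hΨ : Measurable Ψ) : frac N L j Ψ ≠ ⊤ :=
  ne_top_of_le_ne_top ENNReal.one_ne_top (frac_le_one L j hΨ)

/-- The one-particle density of a Dirichlet state vanishes off the box. -/
theorem oneParticleDensity_eq_zero {L : ℝ} (Ψ : TrialState (n + 1) L) {x : Space} (hx : x ∉ box L) :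
    oneParticleDensity (n + 1) Ψ.ψ x = 0 := by
  simp [oneParticleDensity, sliceMass, slice_eq_zero' Ψ hx]

/-- The box lies in the level-0 cube. -/
theorem box_subset_subCell_zero (L : ℝ) (q : SubIdx (2 ^ 0)) : box L ⊆ subCell (L / 2 ^ 0) q := by
  intro x hx
  rw [mem_subCell]
  intro i
  have hq : ((q i : ℕ) : ℝ) = 0 := by
    have : (q i : ℕ) = 0 := by have := (q i).isLt; omega
    rw [this, Nat.cast_zero]
  have h := hx i
  simp only [Set.mem_Ioo] at h
  rw [hq]; simp; exact ⟨h.1.le, h.2⟩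

/-- **Top level**: the expected particle number in the level-0 cube is `N`. -/
theorem mass_level_zero {L : ℝ} (Ψ : TrialState (n + 1) L) (q : SubIdx (2 ^ 0)) :
    mass (n + 1) (subCell (L / 2 ^ 0) q) Ψ.ψ = (n + 1 : ℝ≥0∞) := by
  have hΨ : Measurable Ψ.ψ := Ψ.contDiff.continuous.measurable
  rw [mass, setLIntegral_eq_of_support_subset, lintegral_oneParticleDensity hΨ, Ψ.norm_eq, mul_one]
  intro x hx
  by_contra h
  exact hx (oneParticleDensity_eq_zero Ψ fun hb => h (box_subset_subCell_zero L q hb))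

/-- **`Φ_0 ≤ λ_max/N`**: a lower bound on the top-level fraction is a lower bound on `λ_max`. -/
theorem mul_le_maxOccupation_of_le_frac_zero {L : ℝ} (Ψ : TrialState (n + 1) L) {a : ℝ≥0∞}
    (h : a ≤ frac (n + 1) L 0 Ψ.ψ) : a * (n + 1 : ℝ≥0∞) ≤ maxOccupation (n + 1) Ψ.ψ := by
  have h' : a ≤ maxOccupation (n + 1) Ψ.ψ / (n + 1 : ℝ≥0∞) := by
    refine h.trans (iSup_le fun q => ?_)
    rw [mass_level_zero Ψ q]
    gcongr
    exact modeOcc_le_maxOccupation _ _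
  exact (ENNReal.le_div_iff_mul_le (Or.inl (by positivity)) (Or.inl (by simp))).1 h'

end FractionCalculus

end Summit.AtomisticToContinuum.BoseEinsteinCondensation.Theorems.ScaleConvexityFractionCalculus
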